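import Summits.BirchSwinnertonDyer.BirchSwinnertonDyer.Theorems.EisensteinPrimesBSDpOnCellCTelescopeK2PurityOfProp411
import Literature.NumberTheory.IwasawaTheory.Greenberg2006.CoinducedModuleDual
import Literature.NumberTheory.IwasawaTheory.Greenberg2016.LOC2Archimedean
import HarnessLib

/-!
# Crux 4 `BSDpOnCellC` (stmt-BirchSwinnertonDyer-19034), line «telescope», workfile `Lines/telescopeK2weight2.lean` v1.2,
# sub-leaf W4⁰ (`K2Weight2.stub_bigPseudoNullPTorsion`), route G′ DOCKED AT `R := B = ℤ_p⟦X⟧⟦T⟧`: the rows (G2) "bigger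
# ring `R`", (G3) "`𝐃` cofree over `R` + RFX(𝐃)", W1 "`𝐃` cofinitely generated" and the archimedean half of (G7) "LOC⁽²⁾ on `Σ`"
# of `TelescopeK2PurityOfProp411` DISCHARGED from the single input (cof) "`A` is cofree over `ℤ_p⟦X⟧`"
# (ideator seat `bsd-idea-12` gen 40; `--supports stmt-BirchSwinnertonDyer-19034 --as helper`; THEOREMS ONLY; closes nothing)

HONEST FRAMING. No registered stub, no crux, no summit statement is proved here; BSD is proved for no curve. Part 9
(`Theorems/EisensteinPrimesBSDpOnCellCTelescopeK2PurityOfProp411.lean`,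
`forall_isPseudoNull_XBig_exists_pow_smul_eq_zero_of_prop411`) assembled route G′ of the memo
`Cruxes/BSDpOnCellC/W-PRICING-n2.md` (rev 1.10 §W4-G′): GRANTED Greenberg 2016 Prop. 4.1.1 (named fact `h411`) and the displayed
Greenberg-side rows (G2)–(G8), every pseudo-null `B`-submodule of `X₂ = XBig κ ρ 𝔮 Σ₀` is `p`-power torsion (W4⁰). THIS FILE
removes four of those rows by taking Prop. 4.1.1's bigger ring to be `R := B = Λ₂ = ℤ_p⟦X⟧⟦T⟧` itself (`Algebra.id`):

* (G2) the standing clauses of `R`: `B` is a complete Noetherian local ring with finite residue field of characteristic `p`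
  (tree: `isAdicComplete_maximalIdeal_iwasawaAlgebraTwoVar`, `finite_residueField_iwasawaAlgebraTwoVar`,
  `charP_residueField_iwasawaAlgebraTwoVar`, Mathlib instances), `B → R` injective and finite (identity), `ρ_S` is `R`-linear
  (`LinearMap.map_smul`);
* (G3) `IsCofree B 𝐃` and RFX(𝐃) for `𝐃 = BigRepModule ℤ_p⟦X⟧ p A = A ⊗ Λ_T^*`: the tree's STRUCTURE THEOREM of the co-induced
  module (`Literature/…/Greenberg2006/CoinducedModuleDual.lean`, `BigRepModule.isCofree`: "`𝒟 = 𝒯 ⊗_Λ Λ̂` is a cofree `Λ`-module",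
  [Greenberg2006] p. 342 L5–11, via the Mahler transform [CoatesSujatha2006Cyclotomic] Thm. 3.3.3) turns the ONE input
  (cof) `Greenberg2016.IsCofree ℤ_p⟦X⟧ A` — offered by the LEAD `cruxlead-19034` g4 for the v13 reshape «FD⁺ ↦ FD⁺ ∧ (cof)»
  (bsd-eis/STATUS 2026-08-30 05:46Z (a)) — plus the `p`-primarity of `A` into `IsCofree B 𝐃`; RFX(𝐃) is `IsCofree.rfx`
  ("Obviously, RFX(`𝒟`) is satisfied", [Greenberg2016Selmer] §4.3 p. 20 L23) and W1 `IsCofinitelyGenerated B 𝐃` is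
  `IsCofree.isCofinitelyGenerated`;
* (G7), archimedean half: LOC_v⁽²⁾(𝐃) at every infinite place of the totally complex `K` (`hTC`) is the tree theorem
  `Greenberg2016.loc2_inl_of_forall_isComplex` (`Γ_{K_v} = 1`, `T*/(T*)^{G_{K_v}} = 0`), so (G7) shrinks to the FINITE places
  `w ∈ S`;
* the corank bookkeeping the remaining rows (G4) LEO / (G8) CRK will need: `corank_B 𝐃 = rank_{ℤ_p⟦X⟧} A^∨`
  (`hasCorank_bigRepModule_of_isCofree`, the one-variable twin of the tree's `IndModule₂.hasCorank`);
* the `p`-primarity of `A` in the cell's form `∃ j, C(p)^j • a = 0` (the conclusion of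
  `TelescopeK2FibreCofinite.exists_C_pow_smul_eq_zero_of_fd` from (tor) + (fd₀)) converted to the `ℕ`-form `∃ k, p^k • a = 0`
  that the structure theorem consumes (`pPrimary_of_C_pow_smul_eq_zero`).

REMAINING displayed rows after this file (all for `𝓛` / `𝐃`, none about the core; memo table §W4-G′): `h411` (PUB, named fact);
(cof) + `p`-primarity of `A`; (G4) LEO(𝐃); (G5) LOC⁽¹⁾ at the finite no-index places `w ∈ S ∖ {𝔮}` (`w ∣ p` or `w ∈ Σ₀`), one
of them `𝔭 ∣ p`, `𝔭 ≠ 𝔮`; (G7-fin) LOC⁽²⁾ at the finite `w ∈ S`; (G8) CRK(𝐃, 𝓛); `hTC`; `S`-bookkeeping. No `def`, no `instance`,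
no named fact introduced, no `sorry`. AI-typed, kernel-checked.

References: R. Greenberg, Doc. Math. Extra Vol. Coates (2006) p. 342 L5–11, L34–41 [Greenberg2006]; R. Greenberg, On the
structure of Selmer groups (2016), §1 p. 4 L5–13 (the arena), §2.1 p. 6 L1–10 (LOC⁽²⁾), Prop. 4.1.1 (c), §4.3 p. 20 L19–23
[Greenberg2016Selmer]; J. Coates, R. Sujatha, Cyclotomic Fields and Zeta Values (2006) §3.3, Thm. 3.3.3 (Mahler transform)
[CoatesSujatha2006Cyclotomic]; C. Skinner, E. Urban, Invent. math. 195 (2014) Prop. 3.2.3 (`Λ^* = lim Maps(Γ/Γ^{pⁿ}, ·)`)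
[SkinnerUrban2014].
-/

set_option linter.dupNamespace false
set_option autoImplicit false

noncomputable section

open Function
open Field IsDedekindDomain NumberField IsLocalRing
open Literature.NumberTheory.GaloisRepresentations Literature.NumberTheory.EllipticCurves
open Literature.NumberTheory.EllipticCurves.BigGaloisRep Literature.NumberTheory.IwasawaTheory
open Literature.NumberTheory.IwasawaTheory.Greenberg2016 Literature.NumberTheory.IwasawaTheory.Greenberg2006
open scoped NumberField

namespace Summit.BirchSwinnertonDyer.BirchSwinnertonDyer.Theorems.TelescopeK2PurityOfProp411OfCofree

/-! ## §1 The module side at `R := B`: cofree, RFX, cofinitely generated, corank; `p`-primarity in `ℕ`-form -/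

section Module

variable (p : ℕ) [Fact p.Prime] {A : Type} [AddCommGroup A] [Module (IwasawaAlgebra p) A]

/-- **The `p`-primarity of `A` in `ℕ`-form from the cell's `C(p)`-form**: `C(p)^j • a = 0` in the `ℤ_p⟦X⟧`-module `A`
(the conclusion of `TelescopeK2FibreCofinite.exists_C_pow_smul_eq_zero_of_fd`, (tor) + (fd₀)) gives `p^j • a = 0`
(`(p : ℤ_p⟦X⟧) = C(p)`, `map_natCast`). [cite: SkinnerUrban2014, Prop. 3.2.3 (Λ^* = lim Maps(Γ/Γ^{pⁿ}, ·), p-primary values)] -/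
theorem pPrimary_of_C_pow_smul_eq_zero
    (h : ∀ a : A, ∃ j : ℕ, (PowerSeries.C (p : ℤ_[p]) : PowerSeries ℤ_[p]) ^ j • a = 0) :
    ∀ a : A, ∃ k : ℕ, p ^ k • a = 0 := fun a => by
  obtain ⟨j, hj⟩ := h a
  refine ⟨j, ?_⟩
  rw [← Nat.cast_smul_eq_nsmul (IwasawaAlgebra p), Nat.cast_pow, ← map_natCast (PowerSeries.C (R := ℤ_[p])) p]
  exact hj

/-- **(G3) at `R := B`: `𝐃 = A ⊗ Λ_T^*` is COFREE over `B = ℤ_p⟦X⟧⟦T⟧`** as soon as the `p`-primary `ℤ_p⟦X⟧`-module `A` is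
cofree over `ℤ_p⟦X⟧` — the tree's structure theorem of the co-induced module (`BigRepModule.isCofree`, Mahler transform), read at
`𝒪 = ℤ_p⟦X⟧`. [cite: Greenberg2006, p. 342 L5–11 ("𝒟 = 𝒯 ⊗_Λ Λ̂, which is a cofree Λ-module")]
[cite: CoatesSujatha2006Cyclotomic, Thm. 3.3.3 (§3.3 p. 37)] -/
theorem isCofree_bigRepModule_of_isCofree (hA : ∀ a : A, ∃ k : ℕ, p ^ k • a = 0)
    (hcof : IsCofree (IwasawaAlgebra p) A) :
    IsCofree (IwasawaAlgebra₂ p) (BigRepModule (IwasawaAlgebra p) p A) :=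
  BigRepModule.isCofree hA hcof

/-- **RFX(𝐃) at `R := B`** from (cof) ("Obviously, RFX(`𝒟`) is satisfied"). [cite: Greenberg2016Selmer, §4.3 p. 20 L23] -/
theorem rfx_bigRepModule_of_isCofree (hA : ∀ a : A, ∃ k : ℕ, p ^ k • a = 0)
    (hcof : IsCofree (IwasawaAlgebra p) A) :
    RFX (IwasawaAlgebra₂ p) (BigRepModule (IwasawaAlgebra p) p A) :=
  (BigRepModule.isCofree hA hcof).rfx

/-- **W1 `𝐃` cofinitely generated over `B`** from (cof). [cite: Greenberg2006, §4 p. 367 L33–39] -/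
theorem isCofinitelyGenerated_bigRepModule_of_isCofree (hA : ∀ a : A, ∃ k : ℕ, p ^ k • a = 0)
    (hcof : IsCofree (IwasawaAlgebra p) A) :
    IsCofinitelyGenerated (IwasawaAlgebra₂ p) (BigRepModule (IwasawaAlgebra p) p A) :=
  IsCofree.isCofinitelyGenerated (BigRepModule.isCofree hA hcof)

/-- **`corank_B 𝐃 = rank_{ℤ_p⟦X⟧} Hom(A, ℚ/ℤ)`** — the corank input of Greenberg's Euler–Poincaré bookkeeping (rows (G4) LEO,
(G8) CRK) for `𝐃 = A ⊗ Λ_T^*`, from (cof): the one-variable twin of the tree's `IndModule₂.hasCorank` ("`𝒯` is a free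
`Λ`-module of rank `n`"). [cite: Greenberg2006, p. 342 L5–11] -/
theorem hasCorank_bigRepModule_of_isCofree (hA : ∀ a : A, ∃ k : ℕ, p ^ k • a = 0)
    (hcof : IsCofree (IwasawaAlgebra p) A) :
    HasCorank (IwasawaAlgebra₂ p) (BigRepModule (IwasawaAlgebra p) p A)
      (Module.finrank (IwasawaAlgebra p) (CharacterModule A)) := by
  obtain ⟨hfree, hfin⟩ := hcof.characterModule
  exact BigRepModule.hasCorank_of_basis hA (isDualPairing_characterModule (IwasawaAlgebra p) A)
    (Module.finBasis (IwasawaAlgebra p) (CharacterModule A))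

end Module

/-! ## §2 Route G′ docked at `R := B` -/

section Main

variable {K : Type} [Field K] [NumberField K] (p : ℕ) [Fact p.Prime]
  {A : Type} [AddCommGroup A] [Module (IwasawaAlgebra p) A] [TopologicalSpace A] [DiscreteTopology A]
  [TopologicalSpace (IwasawaAlgebra p)] [TopologicalSpace (IwasawaAlgebra₂ p)]
  [IsTopologicalRing (IwasawaAlgebra₂ p)]
  [ContinuousSMul (IwasawaAlgebra₂ p) (BigRepModule (IwasawaAlgebra p) p A)]

/-- **(G7) splits: LOC⁽²⁾ on `Σ` = LOC⁽²⁾ at the finite `w ∈ S`, for a totally complex `K`** — the archimedean places of `Σ`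
carry LOC_v⁽²⁾(𝐃) for free (`Γ_{K_v} = 1`, tree `loc2_inl_of_forall_isComplex`). [cite: Greenberg2016Selmer, §2.1 p. 6 L1–10, §1 p. 3 L2–4]
[cite: Greenberg2006, p. 342 L34–36] -/
theorem loc2_of_finite_of_forall_isComplex (S : Set (HeightOneSpectrum (𝓞 K)))
    {Λ : Type} [CommRing Λ] [TopologicalSpace Λ] {D : Type} [AddCommGroup D] [Module Λ D] [TopologicalSpace D]
    (τ : ContinuousRep (GaloisGroupUnramifiedOutside K S) Λ D)
    (hTC : ∀ v : InfinitePlace K, v.IsComplex)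
    (hfin : ∀ w ∈ S, LOC2 S τ (Sum.inr w)) :
    ∀ v : Place K, InSigma S v → LOC2 S τ v := fun v hv => by
  cases v with
  | inl w => exact loc2_inl_of_forall_isComplex S τ hTC w
  | inr w => exact hfin w hv

/-- **Route G′ at Selmer level, docked at `R := B` (W4⁰ from Prop. 4.1.1 (c) at the core `𝓛'`, rows (G2), (G3), W1 and
the archimedean half of (G7) discharged).** Notation: `B = IwasawaAlgebra₂ p = ℤ_p⟦X⟧⟦T⟧`, `𝐃 = BigRepModule ℤ_p⟦X⟧ p A` with
the action `AnticyclotomicBigGaloisRep κ ρ`, `ρ_S = descendUnramified S 𝐃 hS`, `𝓛 = specOfIndexSet S ρ_S (strictSet p 𝔮 Σ₀)`.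
GRANTED Greenberg 2016 Prop. 4.1.1 (`h411`, named fact), (cof) `IsCofree ℤ_p⟦X⟧ A` with `A` `p`-primary, (G4) LEO(𝐃), (G5)
LOC⁽¹⁾ at the finite no-index places of `S ∖ {𝔮}` (one of them `𝔭 ∣ p`), (G7-fin) LOC⁽²⁾ at the finite `w ∈ S`, (G8)
CRK(𝐃, 𝓛) and `hTC`, every pseudo-null `B`-submodule of every Pontryagin dual `X` of `S_𝓛(K, 𝐃)` is killed by a power of
`p`. Proof: part 9 at `R := B` (`Algebra.id`), with `IsCofree B 𝐃` from the structure theorem of the co-induced module,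
RFX / cofinite generation from cofreeness, the standing clauses of `B` from `IwasawaAlgebraTwoVar`, and LOC⁽²⁾ at the
complex places from `LOC2Archimedean`. [cite: Greenberg2016Selmer, Prop. 4.1.1 (c), §1 p. 4 L5–13, §2.1 p. 6 L1–10, §4.3 p. 20 L19–23]
[cite: Greenberg2006, p. 342 L5–11] [cite: CoatesSujatha2006Cyclotomic, Thm. 3.3.3 (§3.3 p. 37)] -/
theorem forall_isPseudoNull_exists_pow_smul_eq_zero_of_prop411_of_isCofree
    (h411 : Greenberg2016.prop411_selmer_isAlmostDivisible)
    (κ : ZpExtension K p) (ρ : ContinuousRep (absoluteGaloisGroup K) (IwasawaAlgebra p) A)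
    (hA : ∀ a : A, ∃ k : ℕ, p ^ k • a = 0) (hcof : IsCofree (IwasawaAlgebra p) A)
    (S : Set (HeightOneSpectrum (𝓞 K))) (hSf : S.Finite)
    (hSp : ∀ v : HeightOneSpectrum (𝓞 K), ((p : ℕ) : 𝓞 K) ∈ v.asIdeal → v ∈ S)
    (hS : ramificationSubgroup K S ≤ (AnticyclotomicBigGaloisRep κ ρ).ker)
    (𝔮 : HeightOneSpectrum (𝓞 K)) (Sig : Set (HeightOneSpectrum (𝓞 K)))
    (hLEO : Greenberg2016.LEO S (TelescopeK2RepDescent.descendUnramified S (AnticyclotomicBigGaloisRep κ ρ) hS))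
    (hLOC2 : ∀ w ∈ S,
      Greenberg2016.LOC2 S (TelescopeK2RepDescent.descendUnramified S (AnticyclotomicBigGaloisRep κ ρ) hS) (Sum.inr w))
    (𝔭 : HeightOneSpectrum (𝓞 K)) (h𝔭S : 𝔭 ∈ S) (h𝔭p : ((p : ℕ) : 𝓞 K) ∈ 𝔭.asIdeal) (h𝔭q : 𝔭 ≠ 𝔮)
    (hLOC1 : ∀ w ∈ S, w ≠ 𝔮 → (((p : ℕ) : 𝓞 K) ∈ w.asIdeal ∨ w ∈ Sig) →
      Greenberg2016.LOC1 S (TelescopeK2RepDescent.descendUnramified S (AnticyclotomicBigGaloisRep κ ρ) hS) (Sum.inr w))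
    (hCRK : (TelescopeK2SelmerDictionary.specOfIndexSet S
      (TelescopeK2RepDescent.descendUnramified S (AnticyclotomicBigGaloisRep κ ρ) hS) (strictSet p 𝔮 Sig)).CRK)
    (hTC : ∀ v : InfinitePlace K, v.IsComplex)
    {X : Type} [AddCommGroup X] [Module (IwasawaAlgebra₂ p) X]
    {toDual : X →+ (↥(TelescopeK2SelmerDictionary.specOfIndexSet S
      (TelescopeK2RepDescent.descendUnramified S (AnticyclotomicBigGaloisRep κ ρ) hS) (strictSet p 𝔮 Sig)).selmer →+
        AddCircle (1 : ℚ))}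
    (hX : Greenberg2016.IsDualPairing (IwasawaAlgebra₂ p) ↥(TelescopeK2SelmerDictionary.specOfIndexSet S
      (TelescopeK2RepDescent.descendUnramified S (AnticyclotomicBigGaloisRep κ ρ) hS) (strictSet p 𝔮 Sig)).selmer
        toDual) :
    ∀ P : Submodule (IwasawaAlgebra₂ p) X, Module.IsPseudoNull (IwasawaAlgebra₂ p) ↥P →
      ∃ n : ℕ, ∀ x ∈ P, (((p : ℕ) : IwasawaAlgebra₂ p) ^ n) • x = 0 := by
  have hcofree : IsCofree (IwasawaAlgebra₂ p) (BigRepModule (IwasawaAlgebra p) p A) := BigRepModule.isCofree hA hcof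
  exact TelescopeK2PurityOfProp411.forall_isPseudoNull_exists_pow_smul_eq_zero_of_prop411 p h411 κ ρ
    (IsCofree.isCofinitelyGenerated hcofree) S hSf hSp hS 𝔮 Sig (IwasawaAlgebra₂ p) (fun _ _ h => h)
    (Module.Finite.self (IwasawaAlgebra₂ p)) (isAdicComplete_maximalIdeal_iwasawaAlgebraTwoVar p)
    (finite_residueField_iwasawaAlgebraTwoVar p) (charP_residueField_iwasawaAlgebraTwoVar p)
    (fun g r d => (TelescopeK2RepDescent.descendUnramified S (AnticyclotomicBigGaloisRep κ ρ) hS g).map_smul r d)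
    hcofree hcofree.rfx hLEO
    (loc2_of_finite_of_forall_isComplex S _ hTC hLOC2) 𝔭 h𝔭S h𝔭p h𝔭q hLOC1 hCRK hTC hX

/-- **Route G′ at `X₂ = XBig κ ρ 𝔮 Σ₀` (the W4⁰ conclusion shape), docked at `R := B`.** With `𝔮 ∈ S` and
`S ⊇ Σ₀ ∪ {w ∣ p}` (`hSig`): GRANTED Prop. 4.1.1 (`h411`), (cof) `IsCofree ℤ_p⟦X⟧ A` with `A` `p`-primary, (G4) LEO(𝐃),
(G5) LOC⁽¹⁾ at the finite no-index places of `S ∖ {𝔮}` (one of them `𝔭 ∣ p`, `𝔭 ≠ 𝔮`), (G7-fin) LOC⁽²⁾ at the finite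
`w ∈ S`, (G8) CRK(𝐃, 𝓛) and `hTC`, every pseudo-null `B`-submodule of `XBig κ ρ 𝔮 Σ₀` is killed by a power of `p`.
[cite: Greenberg2016Selmer, Prop. 4.1.1 (c), §1 p. 3 L22–34, §1 p. 4 L5–13, §4.3 p. 20 L19–23] [cite: Greenberg2006, p. 342 L5–11]
[cite: CoatesSujatha2006Cyclotomic, Thm. 3.3.3 (§3.3 p. 37)] -/
theorem forall_isPseudoNull_XBig_exists_pow_smul_eq_zero_of_prop411_of_isCofree
    (h411 : Greenberg2016.prop411_selmer_isAlmostDivisible)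
    (κ : ZpExtension K p) (ρ : ContinuousRep (absoluteGaloisGroup K) (IwasawaAlgebra p) A)
    (hA : ∀ a : A, ∃ k : ℕ, p ^ k • a = 0) (hcof : IsCofree (IwasawaAlgebra p) A)
    (S : Set (HeightOneSpectrum (𝓞 K))) (hSf : S.Finite)
    (hSp : ∀ v : HeightOneSpectrum (𝓞 K), ((p : ℕ) : 𝓞 K) ∈ v.asIdeal → v ∈ S)
    (hS : ramificationSubgroup K S ≤ (AnticyclotomicBigGaloisRep κ ρ).ker)
    (𝔮 : HeightOneSpectrum (𝓞 K)) (h𝔮S : 𝔮 ∈ S) (Sig : Set (HeightOneSpectrum (𝓞 K)))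
    (hSig : ∀ w : HeightOneSpectrum (𝓞 K), w ∉ S → w ∉ Sig ∧ ((p : ℕ) : 𝓞 K) ∉ w.asIdeal)
    (hLEO : Greenberg2016.LEO S (TelescopeK2RepDescent.descendUnramified S (AnticyclotomicBigGaloisRep κ ρ) hS))
    (hLOC2 : ∀ w ∈ S,
      Greenberg2016.LOC2 S (TelescopeK2RepDescent.descendUnramified S (AnticyclotomicBigGaloisRep κ ρ) hS) (Sum.inr w))
    (𝔭 : HeightOneSpectrum (𝓞 K)) (h𝔭S : 𝔭 ∈ S) (h𝔭p : ((p : ℕ) : 𝓞 K) ∈ 𝔭.asIdeal) (h𝔭q : 𝔭 ≠ 𝔮)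
    (hLOC1 : ∀ w ∈ S, w ≠ 𝔮 → (((p : ℕ) : 𝓞 K) ∈ w.asIdeal ∨ w ∈ Sig) →
      Greenberg2016.LOC1 S (TelescopeK2RepDescent.descendUnramified S (AnticyclotomicBigGaloisRep κ ρ) hS) (Sum.inr w))
    (hCRK : (TelescopeK2SelmerDictionary.specOfIndexSet S
      (TelescopeK2RepDescent.descendUnramified S (AnticyclotomicBigGaloisRep κ ρ) hS) (strictSet p 𝔮 Sig)).CRK)
    (hTC : ∀ v : InfinitePlace K, v.IsComplex) :
    ∀ P : Submodule (IwasawaAlgebra₂ p) (XBig κ ρ 𝔮 Sig), Module.IsPseudoNull (IwasawaAlgebra₂ p) ↥P →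
      ∃ n : ℕ, ∀ x ∈ P, (((p : ℕ) : IwasawaAlgebra₂ p) ^ n) • x = 0 := by
  have hcofree : IsCofree (IwasawaAlgebra₂ p) (BigRepModule (IwasawaAlgebra p) p A) := BigRepModule.isCofree hA hcof
  exact TelescopeK2PurityOfProp411.forall_isPseudoNull_XBig_exists_pow_smul_eq_zero_of_prop411 p h411 κ ρ
    (IsCofree.isCofinitelyGenerated hcofree) S hSf hSp hS 𝔮 h𝔮S Sig hSig (IwasawaAlgebra₂ p) (fun _ _ h => h)
    (Module.Finite.self (IwasawaAlgebra₂ p)) (isAdicComplete_maximalIdeal_iwasawaAlgebraTwoVar p)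
    (finite_residueField_iwasawaAlgebraTwoVar p) (charP_residueField_iwasawaAlgebraTwoVar p)
    (fun g r d => (TelescopeK2RepDescent.descendUnramified S (AnticyclotomicBigGaloisRep κ ρ) hS g).map_smul r d)
    hcofree hcofree.rfx hLEO
    (loc2_of_finite_of_forall_isComplex S _ hTC hLOC2) 𝔭 h𝔭S h𝔭p h𝔭q hLOC1 hCRK hTC

end Main

end Summit.BirchSwinnertonDyer.BirchSwinnertonDyer.Theorems.TelescopeK2PurityOfProp411OfCofree

end
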